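import Summits.CriticalPhenomena.PercolationContinuityZ3.Theorems.FK.Transplant.KNFreeStepIVInterface
import Summits.CriticalPhenomena.PercolationContinuityZ3.Theorems.FK.Transplant.KNFreeSlabStepIV
import HarnessLib

/-!
# FRONTIER TRANSPLANT, binder 2 (TP_FK) — T4-SLAB (P4s): the SLAB STEP-IV SUPPLIER — `FKStepIVAt q p δ H M j₀ R₀` for every
# finite family `H` of centred box geometries and every tolerance `δ > 0`, from the slab property `Π(p, L)` alone (`q ≥ 1`, `d ≥ 3`)

Support file (`--supports stmt-CriticalPhenomena-4575`, helper) of the FRONTIER TRANSPLANT sub-cell (`fk-continuity/transplant/`,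
seat `prim-bschramm-fkt-p1`); builds on p205010 (kernel theorem, internal audit signed; external expert review pending).
0 definitions · 0 named facts · 0 sorries · standard axioms. File 16/18 of the bytes-first package (R60 (3)(β)) of the
UNFUNDED memo row `T4-SLAB [g122, R60]` (re-described R62 (E)); proposable only on a coordinator ruling.
Registered R63 (cell INBOX l.4709, 2026-08-23); registry row T4s; lead label T4s-16 (fkt-lead L22, l.4677).

HONEST FRAMING (page 1, cell rule). The transplant's theorem of record `ufsc0_of_freeBoundaryHypothesis_r3` (p248245) is
CONDITIONAL on FH AND on TP_FK = `KNFreeTargetHittable d q p`, both OPEN at the same `p` for `q > 1` near `p_c(q)` (⇔ GRC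
Conj. (5.103) via K1; barrier note `Literature.Barriers.CriticalPhenomena.SamePFreeBoundaryCriteria`, FBN-01, cited first);
the transplant is a typed reduction, not a proof of FK continuity. THIS FILE inhabits T2s's Step-IV interface `FKStepIVAt`
(R62; `KNFreeStepIVInterface.lean`) above the slab threshold `p̂_c(q) ≥ p_c(q)` (equality = GRC Conj. (5.103), open for
`q ∉ {1, 2}`) for families of CENTRED BOX geometries only: binder 2 (`KNFreeTargetHittable d q p`, ALL FK-hittable `H`) is
BYPASSED for the record's target families, NOT proved (R60 (4): the literal binder 2 is not reachable from `Π(p, L)` by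
shell conditioning); NOT a binder discharge, NOT `_r4`; nothing at `p ↓ p_c(q)` (K1/C5); `_r3` « 2 / 0 ☑ », n_open = 2,
BINDER-OWNERS, FO-19 NO-GO unchanged.

THE SUPPLIER. Frozen set `S` = the GATED collar of `X_j` of width `T = 2L+1` (`KNFreeSlabGates`): under the free thin-shell
law the face `U(x)` of a contact sees, inward, a fan of `n` disjoint sub-plates of placed slab copies (`KNFreeSlabPlates`),
each contributing an independent trial (`KNFreeSequentialTrials`) whose success — a lane from the plate's exit through a gate
column and the c-slab-confined corridor of `KNFreeSlabLanes` to the far set `v + ℓF` of the look box — has pinned-law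
probability `≥ γ = p̃^{2T+4}·β^{2d·m⋆}` uniformly (`KNFreeSlabStepIV.slabStepIV_contact`); the constants `n, n′, M₀, M_w`
are fixed here from `(δ, β, K_Q)`. The interface's face half-side is `M = 2M_w + 1` (its width hypothesis `2M + 2` then
gives the lanes' `4M_w + 4`; `uface_mono` puts the relay found in the `M_w`-face into the `M`-face), `j₀ = 1`,
`R₀ = 6M_w + 20L + 38`.

* `uface_mono` — Kozma–Nitzan's faces `U(P)` grow with the window half-side.
* `slab_hIV` — the Step-IV inequality at every contact of a wide level, for fixed constants.
* `fkStepIVAt_of_fkSlabPercolation` — `3 ≤ d`, `1 ≤ q`, `0 < p`, `Π(p, L)`, `0 < δ`, `H ⊆ IsBoxGeom` ⟹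
  `∃ M j₀ R₀, FKStepIVAt q p δ H M j₀ R₀`.

References: G. Kozma, S. Nitzan, arXiv:2401.12397 (2024), §4 Lemma 10 Step IV (pp. 19–21) [KozmaNitzan2024]; G. Grimmett,
*The Random-Cluster Model*, Springer 2006, Thm. (3.1) (3.4), Thm. (3.7), Thm. (3.8), eq. (3.22), §5.7 (5.102), Conj. (5.103) [Grimmett2006].
-/

noncomputable section

open MeasureTheory
open scoped ENNReal Classical

namespace Summit.CriticalPhenomena.PercolationContinuityZ3.Theorems.FK

open Literature.Probability.Percolation Literature.Probability.LatticeModels SimpleGraph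
open Literature.Probability.Percolation.KozmaNitzan Transplant Literature.Barriers.CriticalPhenomena

variable {d : ℕ}

/-- The fatness unit of a contact at scale `ℓ`: `Nbig = ⌊(ℓ - 2M - 6L - 11)/8⌋` satisfies the three side conditions of
`slabStepIV_contact` once `ℓ ≥ 6M + 20L + 38` and the aspect of `Q` is at most `K`. [folklore] -/
theorem exists_fatness_unit (M L K ℓ : ℕ) (hℓ : 6 * M + 20 * L + 38 ≤ ℓ) :
    ∃ Nbig : ℕ, L ≤ Nbig ∧ 2 * (M : ℤ) + 2 * (2 * L + 1) + 6 * Nbig + 2 * L + 9 ≤ ℓ ∧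
      ∀ D : ℤ, D ≤ K → (ℓ : ℤ) * D + 2 * M + 2 ≤ ((16 * K + 16 : ℕ) : ℤ) * Nbig := by
  refine ⟨(ℓ - (2 * M + 6 * L + 11)) / 8, ?_, ?_, fun D hD => ?_⟩
  · apply Nat.le_div_iff_mul_le (by norm_num) |>.2; omega
  · have h1 : 8 * ((ℓ - (2 * M + 6 * L + 11)) / 8) ≤ ℓ - (2 * M + 6 * L + 11) := Nat.mul_div_le _ 8
    have h2 : ((ℓ - (2 * M + 6 * L + 11) : ℕ) : ℤ) = ℓ - (2 * M + 6 * L + 11) := by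
      rw [Nat.cast_sub (by omega)]; push_cast; ring
    have h3 : (8 : ℤ) * (((ℓ - (2 * M + 6 * L + 11)) / 8 : ℕ) : ℤ) ≤ ℓ - (2 * M + 6 * L + 11) := by
      rw [← h2]; exact_mod_cast h1
    linarith
  · set N := (ℓ - (2 * M + 6 * L + 11)) / 8 with hN
    have h1 : ℓ - (2 * M + 6 * L + 11) < 8 * N + 8 := by
      have := Nat.div_add_mod (ℓ - (2 * M + 6 * L + 11)) 8
      have := Nat.mod_lt (ℓ - (2 * M + 6 * L + 11)) (show 0 < 8 by norm_num)
      omega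
    have h2 : (ℓ : ℤ) - (2 * M + 6 * L + 11) ≤ 8 * (N : ℤ) + 7 := by
      have : ((ℓ - (2 * M + 6 * L + 11) : ℕ) : ℤ) = ℓ - (2 * M + 6 * L + 11) := by
        rw [Nat.cast_sub (by omega)]; push_cast; ring
      rw [← this]; exact_mod_cast Nat.lt_succ_iff.1 h1
    have hK0 : (0 : ℤ) ≤ K := Nat.cast_nonneg K
    have hN0 : (0 : ℤ) ≤ N := Nat.cast_nonneg N
    have hℓ' : 6 * (M : ℤ) + 20 * L + 38 ≤ ℓ := by exact_mod_cast hℓ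
    have hℓD : (ℓ : ℤ) * D ≤ ℓ * K := mul_le_mul_of_nonneg_left hD (Nat.cast_nonneg ℓ)
    push_cast
    nlinarith [mul_nonneg hK0 (show (0 : ℤ) ≤ ℓ - 2 * (2 * M + 6 * L + 11) - 14 by linarith),
      mul_le_mul_of_nonneg_left h2 (show (0 : ℤ) ≤ 2 * K + 2 by linarith)]

/-- Kozma–Nitzan's face `U(P)` of a wide window lies in the level box minus its boundary layer, on layer 1. [folklore] -/
theorem uface_subset_Icc_shrink {Lo Hi : Site d} {M : ℕ} {i : Fin d} {σ : ℤ} {y : Site d} (h : WinHyp Lo Hi M i σ y)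
    {u : Site d} (hu : u ∈ uface Lo Hi M i σ y) :
    u ∈ Finset.Icc (Lo + 1) (Hi - 1) ∧ (u i = Hi i - 1 ∨ u i = Lo i + 1) := by
  rw [mem_uface_iff, mem_plaq_iff] at hu
  obtain ⟨hui, hub⟩ := hu
  simp only [Pi.add_apply, Pi.smul_apply, smul_eq_mul, unitVec_apply_self, mul_one] at hui
  have hui' : u i = y i - σ := by linarith
  refine ⟨mem_Icc_iff.2 fun k => ?_, ?_⟩
  · simp only [Pi.add_apply, Pi.sub_apply, Pi.one_apply]
    by_cases hk : k = i
    · rw [hk, hui']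
      rcases h.face with ⟨hσ, hy⟩ | ⟨hσ, hy⟩ <;> rw [hσ, hy] <;> have := h.wide i <;> constructor <;> linarith
    · have h1 := hub k hk
      simp only [Pi.add_apply, Pi.smul_apply, smul_eq_mul, unitVec_apply_of_ne hk, mul_zero, add_zero] at h1
      have h2 := wctr_mem_of_ne h hk
      rw [abs_le] at h1
      constructor <;> linarith [h1.1, h1.2, h2.1, h2.2]
  · rw [hui']
    rcases h.face with ⟨hσ, hy⟩ | ⟨hσ, hy⟩
    · left; rw [hσ, hy]
    · right; rw [hσ, hy]; ring

/-- **Kozma–Nitzan's faces grow with the window half-side**: for `M_w ≤ M` and a window wide for `M`, the face `U(P)`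
of half-side `M_w` behind `(i, σ, y)` lies in the face of half-side `M` (the clamped centres move by at most the
difference). [cite: KozmaNitzan2024, §4 p. 21 (U(P))] -/
theorem uface_mono {Lo Hi : Site d} {Mw M : ℕ} {i : Fin d} {σ : ℤ} {y : Site d} (hMw : Mw ≤ M)
    (h : WinHyp Lo Hi M i σ y) : uface Lo Hi Mw i σ y ⊆ uface Lo Hi M i σ y := by
  intro u hu
  rw [mem_uface_iff, mem_plaq_iff] at hu ⊢
  refine ⟨hu.1, fun k hk => ?_⟩
  have h1 := hu.2 k hk
  rw [wctr_apply_of_ne hk] at h1 ⊢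
  have hy := h.mem k
  have hw := h.wide k
  have hMw' : (Mw : ℤ) ≤ M := by exact_mod_cast hMw
  unfold clamp at h1 ⊢
  rw [abs_le] at h1 ⊢
  constructor <;> omega

/-- **Slab Step IV along a level** (the hypothesis `hIV` of `stepV_in_fkLaw` at every contact of `B⟨j⟩`), from the
two-point bound of `Π(p, L)` in placed slabs, for a target w.r.t. a family of centred box geometries of aspect `≤ K_Q`.
[cite: KozmaNitzan2024, §4 Lemma 10 Step IV (pp. 19–21); Grimmett2006, §5.7 eq. (5.102)] -/
theorem slab_hIV [NeZero d] (hd : 3 ≤ d) {q : ℝ} (hq : 1 ≤ q) (p : unitInterval) {L : ℕ}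
    {β : ℝ} (hβ0 : 0 ≤ β) (hβ1 : β ≤ 1)
    (hβ : ∀ (N : ℕ) (g : zdGraph d ≃g zdGraph d) (u z : Site d), u ∈ fkSlab d L N → z ∈ fkSlab d L N →
      β ≤ (fkLaw ((fkSlab d L N).image g) (restrW (↑((fkSlab d L N).image g) : Set (Site d)) (lattW d p)) q).real
        (openConnIn (↑((fkSlab d L N).image g) : Set (Site d)) (g u) (g z)))
    (Ld : LData d) (Λ : Finset (Site d)) (W : Sym2 (Site d) → unitInterval) (D : Finset (Site d)) (hsub : IsSubbox W p D)
    (hDS : D ⊆ Λ) (j Mw M R : ℕ) (hj1 : 1 ≤ j) (hjR : j - 1 ≤ R) (hwide : ∀ k', Ld.Lo j k' + 2 * M + 2 ≤ Ld.Hi j k')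
    (hMwM : 2 * Mw + 1 ≤ M) (hXD : Finset.Icc (Ld.Lo j) (Ld.Hi j) ⊆ D)
    (H : List (Geom d)) (hH : ∀ g ∈ H, IsBoxGeom g) (KQ : ℕ) (hKQ' : ∀ g ∈ H, ∀ b, g.hiQ b - g.loQ b ≤ KQ)
    (Tgt : Finset (Site d)) (htgt : IsTarget Tgt Ld.lo Ld.hi D R H) (hRℓ : 6 * Mw + 20 * L + 38 ≤ R)
    (Pbig N_P n n' Pl M₀ : ℕ) (hPbig : Pbig = 2 * N_P + 3) (hn0 : 0 < n) (hnPl : n * Pl ≤ N_P) (hPl : 2 * L + 1 ≤ Pl)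
    (hLN_P : L ≤ N_P) (hM₀c : ((n' : ℤ) + 2) * Pbig ≤ M₀) (hPM₀ : Pbig ≤ M₀) (hM : M₀ + N_P + 2 * L + 3 ≤ Mw)
    {δ : ℝ} (hδn' : (1 - β / 2) ^ n' ≤ 3 * δ)
    (hK : (1 - ((p : ℝ) / (p + q * (1 - p))) ^ ((2 * L + 1) + 2 * L + 5) * β ^ (d * (16 * KQ + 16)) *
      β ^ (d * (16 * KQ + 16))) ^ ⌈β * n / 2⌉₊ < δ) :
    ∀ x ∈ outerBoundary (zdGraph d) (Ld.X j),
      1 - 3 * δ ≤ (fkLaw Λ (restrW (↑(((Finset.Icc (Ld.Lo j + 1) (Ld.Hi j - 1) \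
        Finset.Icc (Ld.Lo j + (((2 * L + 1 : ℕ) : Site d) + 1)) (Ld.Hi j - (((2 * L + 1 : ℕ) : Site d) + 1))).filter
          fun x => ¬ slabGate (Ld.Lo j) (Ld.Hi j) (2 * L + 1) 1 Pbig 0 x)) : Set (Site d)) W) q).real
        {ω | ∃ u ∈ Ld.ufaceX j M x, 1 - δ < (fkLaw Λ (pinW W (wireSet (↑(((Finset.Icc (Ld.Lo j + 1) (Ld.Hi j - 1) \
          Finset.Icc (Ld.Lo j + (((2 * L + 1 : ℕ) : Site d) + 1)) (Ld.Hi j - (((2 * L + 1 : ℕ) : Site d) + 1))).filter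
            fun x => ¬ slabGate (Ld.Lo j) (Ld.Hi j) (2 * L + 1) 1 Pbig 0 x)) : Set (Site d))) ω) q).real
          (⋃ t ∈ Tgt, openConnIn (↑D : Set (Site d)) u t)} := by
  have hq0 : 0 < q := one_pos.trans_le hq
  intro x hx
  obtain ⟨h, -⟩ := LData.winData_spec hwide hx
  -- the same contact window, read with the smaller half-side `Mw`
  have hw : WinHyp (Ld.Lo j) (Ld.Hi j) Mw (Ld.winData j M x).1 (Ld.winData j M x).2.1 (Ld.winData j M x).2.2 :=
    ⟨fun k => by have := h.wide k; omega, h.sign, h.face, h.mem⟩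
  have hwide4 : ∀ b, Ld.Lo j b + 4 * (Mw : ℤ) + 4 ≤ Ld.Hi j b := fun b => by have := h.wide b; omega
  have hvB : vctr (Ld.Lo j) (Ld.Hi j) Mw (Ld.winData j M x).1 (Ld.winData j M x).2.1 (Ld.winData j M x).2.2 ∈
      Finset.Icc (Ld.lo - (R : Site d)) (Ld.hi + (R : Site d)) := by
    have h1 := mem_Icc_iff.1 (vctr_mem_shrink hw)
    refine mem_Icc_iff.2 fun k => ?_
    obtain ⟨h1a, h1b⟩ := h1 k
    simp only [Pi.add_apply, Pi.sub_apply, Pi.natCast_apply, Pi.one_apply] at h1a h1b ⊢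
    have hLok : Ld.Lo j k = Ld.lo k - j := by simp [LData.Lo]
    have hHik : Ld.Hi j k = Ld.hi k + j := by simp [LData.Hi]
    have hjR' : (j : ℤ) - 1 ≤ R := by omega
    constructor <;> linarith
  obtain ⟨ℓ, hRℓ', g, hg, hQ, hF⟩ := htgt.hit _ hvB
  have hbox := hH g hg
  obtain ⟨a, hflat, hflat', hoff⟩ := hbox.flat
  obtain ⟨Nbig, hLN, hℓN, hmN⟩ := exists_fatness_unit Mw L KQ ℓ (by omega)
  have hm : ∀ b, (ℓ : ℤ) * g.hiQ b - ℓ * g.loQ b + 2 * Mw + 2 ≤ ((16 * KQ + 16 : ℕ) : ℤ) * Nbig := by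
    intro b
    have := hmN (g.hiQ b - g.loQ b) (hKQ' g hg b)
    rw [mul_sub] at this; exact this
  have key := slabStepIV_contact hq p hd hβ0 hβ1 hβ Λ W D hsub hDS (Ld.Lo j) (Ld.Hi j) hXD Mw _ _ _ hw hwide4
    1 Pbig N_P n n' Pl M₀ Pbig 0 hPbig hn0 hnPl hPl hLN_P hM₀c hPM₀ hM (le_refl 1) (by omega) (by omega) hPM₀ ℓ g a
    hbox.loQ_le hbox.one_le_hiQ hbox.F_sub_Q
    (fun b => by
      by_cases hba : b = a
      · rw [hba, hflat']
      · have := hoff b hba; linarith)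
    hflat (fun b hb => ⟨(hoff b hb).1, (hoff b hb).2.1⟩) (fun b hb => (hoff b hb).2.2) hQ Tgt hF Nbig (16 * KQ + 16) hLN
    (by omega) hℓN hm hδn' hK
  haveI := isProbabilityMeasure_fkLaw Λ (restrW (↑(((Finset.Icc (Ld.Lo j + 1) (Ld.Hi j - 1) \
    Finset.Icc (Ld.Lo j + (((2 * L + 1 : ℕ) : Site d) + 1)) (Ld.Hi j - (((2 * L + 1 : ℕ) : Site d) + 1))).filter
      fun x => ¬ slabGate (Ld.Lo j) (Ld.Hi j) (2 * L + 1) 1 Pbig 0 x)) : Set (Site d)) W) hq0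
  refine key.trans (measureReal_mono ?_ (measure_ne_top _ _))
  rintro ξ ⟨u, hu, hgood⟩
  exact ⟨u, uface_mono (by omega) h hu, hgood⟩

/-- **The slab Step-IV supplier** (T4-SLAB's Step IV in T2s's interface): for `3 ≤ d`, `1 ≤ q`, `0 < p`, the slab
property `Π(p, L)` (`FKSlabPercolation d p q L`, any `L`), every `δ > 0` and every finite family `H` of centred box
geometries, `∃ M j₀ R₀, FKStepIVAt q p δ H M j₀ R₀` — with `M = 2M_w + 1`, `j₀ = 1`, `R₀ = 6M_w + 20L + 38` and the
frozen set the gated collar of width `2L + 1`. Composed with T2s's `fkTargetAt_of_fkStepIV` it is Kozma–Nitzan's target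
Lemma 10 for `fkLaw` above the slab threshold for such families (`KNFreeSlabUFSC0.fkTargetAt_of_fkSlabPercolation`).
[cite: KozmaNitzan2024, §4 Lemma 10 Step IV (pp. 19–21); Grimmett2006, §5.7 eq. (5.102), Thm. (3.7), Thm. (3.8), eq. (3.22)] -/
theorem fkStepIVAt_of_fkSlabPercolation [NeZero d] (hd : 3 ≤ d) {q : ℝ} (hq : 1 ≤ q) (p : unitInterval)
    (hp0 : 0 < (p : ℝ)) {L : ℕ} (hSP : FKSlabPercolation d (p : ℝ) q L) {δ : ℝ} (hδpos : 0 < δ)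
    (H : List (Geom d)) (hH : ∀ g ∈ H, IsBoxGeom g) : ∃ M j₀ R₀ : ℕ, FKStepIVAt q p δ H M j₀ R₀ := by
  classical
  have hq0 : 0 < q := one_pos.trans_le hq
  -- the slab two-point bound `β`
  obtain ⟨β, hβpos, hβ⟩ := exists_forall_le_fkLaw_image_fkSlab_real_openConnIn hq hSP
  have hβ1 : β ≤ 1 := by
    have h := hβ 0 (zdShiftIso 0) 0 0 (zero_mem_fkSlab d L 0) (zero_mem_fkSlab d L 0)
    haveI := isProbabilityMeasure_fkLaw ((fkSlab d L 0).image (zdShiftIso (0 : Site d)))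
      (restrW (↑((fkSlab d L 0).image (zdShiftIso (0 : Site d))) : Set (Site d)) (lattW d p)) hq0
    exact h.trans measureReal_le_one
  -- the aspect bound `K_Q` of the family and the step count `mstar`
  set KQ : ℕ := (H.map fun g => Finset.univ.sup fun b => (g.hiQ b - g.loQ b).toNat).foldr max 0 with hKQ
  have le_foldr_max_of_mem : ∀ {l : List ℕ} {a : ℕ}, a ∈ l → a ≤ l.foldr max 0 := by
    intro l
    induction l with
    | nil => intro a h; exact absurd h List.not_mem_nil
    | cons b l ih =>
      intro a h
      rw [List.foldr_cons]
      rcases List.mem_cons.1 h with rfl | h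
      · exact le_max_left _ _
      · exact (ih h).trans (le_max_right _ _)
  have hKQ' : ∀ g ∈ H, ∀ b, g.hiQ b - g.loQ b ≤ KQ := by
    intro g hg b
    have h1 : (g.hiQ b - g.loQ b).toNat ≤ Finset.univ.sup fun b => (g.hiQ b - g.loQ b).toNat :=
      Finset.le_sup (f := fun b => (g.hiQ b - g.loQ b).toNat) (Finset.mem_univ b)
    have h2 : (Finset.univ.sup fun b => (g.hiQ b - g.loQ b).toNat) ≤ KQ :=
      le_foldr_max_of_mem (List.mem_map.2 ⟨g, hg, rfl⟩)
    have := Int.self_le_toNat (g.hiQ b - g.loQ b)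
    have h3 : (((g.hiQ b - g.loQ b).toNat : ℕ) : ℤ) ≤ KQ := by exact_mod_cast h1.trans h2
    linarith
  set mstar : ℕ := 16 * KQ + 16 with hmstar
  -- the lane bound `γ`, the number of lanes `n` and of sub-plates `n'`
  set π : ℝ := (p : ℝ) / (p + q * (1 - p)) with hπ
  have hden : 0 < (p : ℝ) + q * (1 - p) := by nlinarith [p.2.2]
  have hπ0 : 0 < π := div_pos hp0 hden
  have hπ1 : π ≤ 1 := by rw [hπ, div_le_one hden]; nlinarith [p.2.2]
  set T : ℕ := 2 * L + 1 with hT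
  set γ : ℝ := π ^ (T + 2 * L + 5) * β ^ (d * mstar) * β ^ (d * mstar) with hγ
  have hγpos : 0 < γ := by positivity
  have hγ1 : γ ≤ 1 := mul_le_one₀ (mul_le_one₀ (pow_le_one₀ hπ0.le hπ1) (pow_nonneg hβpos.le _)
    (pow_le_one₀ hβpos.le hβ1)) (pow_nonneg hβpos.le _) (pow_le_one₀ hβpos.le hβ1)
  obtain ⟨K₀, hK₀⟩ := exists_pow_lt_of_lt_one hδpos (show 1 - γ < 1 by linarith)
  set n : ℕ := ⌈2 * (K₀ : ℝ) / β⌉₊ + 1 with hn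
  have hn0 : 0 < n := by omega
  have hKn : K₀ ≤ ⌈β * n / 2⌉₊ := by
    have h1 : (2 * (K₀ : ℝ) / β) ≤ ⌈2 * (K₀ : ℝ) / β⌉₊ := Nat.le_ceil _
    have hn' : (2 * (K₀ : ℝ) / β) ≤ (n : ℝ) := by rw [hn]; push_cast; linarith
    have h2 : (K₀ : ℝ) ≤ β * n / 2 := by
      have hK : (K₀ : ℝ) = β / 2 * (2 * K₀ / β) := by field_simp
      have := mul_le_mul_of_nonneg_left hn' (show (0 : ℝ) ≤ β / 2 by linarith)
      linarith
    exact_mod_cast (show (K₀ : ℝ) ≤ (⌈β * n / 2⌉₊ : ℕ) from h2.trans (Nat.le_ceil _))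
  have hK : (1 - γ) ^ ⌈β * n / 2⌉₊ < δ := (pow_le_pow_of_le_one (by linarith) (by linarith) hKn).trans_lt hK₀
  obtain ⟨n', hn'⟩ := exists_pow_lt_of_lt_one (show 0 < 3 * δ by positivity) (show 1 - β / 2 < 1 by linarith)
  have hδn' : (1 - β / 2) ^ n' ≤ 3 * δ := hn'.le
  -- the window constants
  set Pl : ℕ := 2 * L + 1 with hPl
  set N_P : ℕ := n * Pl with hNP
  set Pbig : ℕ := 2 * N_P + 3 with hPbig
  set M₀ : ℕ := (n' + 3) * Pbig with hM₀
  set Mw : ℕ := M₀ + N_P + 2 * L + 3 with hMw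
  have hLN_P : L ≤ N_P := by
    rw [hNP, hPl]; have : 1 * L ≤ n * (2 * L + 1) := Nat.mul_le_mul hn0 (by omega); omega
  have hM₀c : ((n' : ℤ) + 2) * Pbig ≤ M₀ := by rw [hM₀]; push_cast; nlinarith
  have hPM₀ : Pbig ≤ M₀ := by rw [hM₀]; nlinarith
  -- the interface constants: face half-side `2 Mw + 1`, from level `1`, inflation `6 Mw + 20 L + 38`
  refine ⟨2 * Mw + 1, 1, 6 * Mw + 20 * L + 38, ?_⟩
  intro Ld W D Tgt R j hL hR₀ hj₀ hjR hwide htgt _ _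
  have hXD : Finset.Icc (Ld.Lo j) (Ld.Hi j) ⊆ D := by rw [← LData.X_eq]; exact hL.X_subset_D (by omega)
  -- the frozen set: the gated collar of `X_j` of width `2L+1`
  set S := ((Finset.Icc (Ld.Lo j + 1) (Ld.Hi j - 1) \ Finset.Icc (Ld.Lo j + (((2 * L + 1 : ℕ) : Site d) + 1))
    (Ld.Hi j - (((2 * L + 1 : ℕ) : Site d) + 1))).filter fun x => ¬ slabGate (Ld.Lo j) (Ld.Hi j) (2 * L + 1) 1 Pbig 0 x)
    with hSdef
  have hS : S ⊆ Finset.Icc (Ld.Lo j + 1) (Ld.Hi j - 1) := gatedCollar_subset _ _ _ _ _ _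
  have hSD : S ⊆ D := hS.trans ((Finset.Icc_subset_Icc (by intro t; simp) (by intro t; simp)).trans hXD)
  -- the faces lie in the shell
  have hUS : ∀ x ∈ outerBoundary (zdGraph d) (Ld.X j), Ld.ufaceX j (2 * Mw + 1) x ⊆ S := by
    intro x hx u hu
    obtain ⟨h, -⟩ := LData.winData_spec hwide hx
    obtain ⟨huI, hui⟩ := uface_subset_Icc_shrink h hu
    refine mem_gatedCollar_of_depth_one _ _ _ _ _ _ (by omega) huI ?_ hui
    have := h.wide (Ld.winData j (2 * Mw + 1) x).1
    push_cast at this ⊢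
    have hMwL : (2 : ℤ) * L + 3 ≤ Mw := by rw [hMw]; push_cast; linarith
    linarith
  refine ⟨S, hS, hSD, hUS, ?_⟩
  exact slab_hIV hd hq p hβpos.le hβ1 hβ Ld Ld.Sfin W D hL.sub hL.DS j Mw (2 * Mw + 1) R (by omega) (by omega) hwide
    le_rfl hXD H hH KQ hKQ' Tgt htgt (by omega) Pbig N_P n n' Pl M₀ hPbig hn0 (by rw [hNP]) (by rw [hPl]) hLN_P hM₀c hPM₀
    (by rw [hMw]) hδn' hK

/-- The supplier in the displayed shape of T2s's `fkTargetAt_of_fkStepIV_class` / `ufsc0_of_fkStepIV` hypotheses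
(`∀ δ ∈ (0, 1]`, class `IsBoxGeom`). [cite: KozmaNitzan2024, §4 Lemma 10 Step IV (pp. 19–21); Grimmett2006, §5.7 eq. (5.102)] -/
theorem fkStepIVAt_isBoxGeom_of_fkSlabPercolation [NeZero d] (hd : 3 ≤ d) {q : ℝ} (hq : 1 ≤ q) (p : unitInterval)
    (hp0 : 0 < (p : ℝ)) {L : ℕ} (hSP : FKSlabPercolation d (p : ℝ) q L) :
    ∀ ⦃δ : ℝ⦄, 0 < δ → δ ≤ 1 → ∀ H : List (Geom d), (∀ g ∈ H, IsBoxGeom g) →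
      ∃ M j₀ R₀ : ℕ, FKStepIVAt q p δ H M j₀ R₀ :=
  fun _ hδ _ H hH => fkStepIVAt_of_fkSlabPercolation hd hq p hp0 hSP hδ H hH

end Summit.CriticalPhenomena.PercolationContinuityZ3.Theorems.FK

end
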